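import Literature.NumberTheory.LFunctions.RayClassPartialZetaUnfold
import Literature.NumberTheory.LFunctions.HeckeThetaContinuation
import HarnessLib

/-!
# Hecke's theorem for ray class characters: the discharge

Topic `Literature/NumberTheory/LFunctions`; namespace `Literature.NumberTheory.LFunctions`.  Sibling proof file of
`RayClassCharacter.lean` (named fact `rayClassLSeries_hasMeromorphicContinuation`, Neukirch VII (8.5)–(8.6) with
Remark 1 and (6.9): the L-series of every Dirichlet character `mod 𝔪` of `K` has a meromorphic continuation to
`ℂ`, holomorphic off `s = 0, 1`) and of `RayClassPartialZeta.lean` (named fact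
`rayClassPartialZeta_hasMeromorphicContinuation`).  The chain of PROVED results

* `HeckeThetaInversion` → `HeckeThetaBounds` → `HeckeThetaMellin` → `HeckeThetaGamma` → `HeckeThetaPieces`
  (theta series of the cosets `a₀ + 𝔞` with sign weights `N(x^p)`, their transformation formula, the weak
  FE-pair of the Mellin principle and the unfolding over `V = ⟨u_i^N⟩`; Neukirch VII (3.6), (8.3)–(8.4)),
* `HeckePieceDirichlet` → `HeckeThetaDirichlet` → `HeckeThetaContinuation` (the signed coset Dirichlet series
  `Σ sgn N(x^p) |N(x)|^{-s}` and their continuation, VII (8.5)),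
* `RayClasses` → `RayClassPartialZeta` → `RayClassPartialZetaUnfold` (narrow ray classes, the reduction of the
  L-series to the partial zeta functions, and of those to the signed coset series, VII §8 Remark 1 with
  (5.3)–(5.4), (6.9))

is assembled here into `rayClassPartialZeta_hasMeromorphicContinuation_holds` and
**`rayClassLSeries_hasMeromorphicContinuation_holds`** (Hecke 1917).

## References

* J. Neukirch, *Algebraic Number Theory*, Grundlehren 322, Springer 1999, Ch. VII §8 (8.5) Theorem, (8.6)
  Corollary and Remark 1; §6 (6.9). [NeukirchANT1999]
* E. Hecke, *Über eine neue Anwendung der Zetafunktionen auf die Arithmetik der Zahlkörper*,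
  Nachr. Ges. Wiss. Göttingen (1917), 90–95.
-/

noncomputable section

namespace Literature.NumberTheory.LFunctions

variable {K : Type*} [Field K] [NumberField K]

/-- **Hecke's theorem for the partial zeta functions of the narrow ray classes of `K`**
(`rayClassPartialZeta_hasMeromorphicContinuation K`, Neukirch VII (8.5) with Remark 1 after (8.6)): from the
continuation of the signed coset series (`NumberField.exists_signedCosetSum_continuation`) by
`rayClassPartialZeta_hasMeromorphicContinuation_of_pieceDirichlet`.
[cite: NeukirchANT1999, Ch. VII §8 (8.5) Theorem and Remark 1 (after (8.6))] -/
theorem rayClassPartialZeta_hasMeromorphicContinuation_holds :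
    rayClassPartialZeta_hasMeromorphicContinuation K :=
  rayClassPartialZeta_hasMeromorphicContinuation_of_pieceDirichlet fun p I _ hN0 hN hV ↦
    NumberField.exists_signedCosetSum_continuation p I 1 hN0 hN hV

variable (K) in
/-- **Hecke (1917): the L-series of every Dirichlet character `mod 𝔪` of the number field `K` has a
meromorphic continuation to `ℂ`, holomorphic outside `s = 0, 1`** — the named fact
`rayClassLSeries_hasMeromorphicContinuation K` of `RayClassCharacter.lean` (Neukirch VII (8.5) Theorem, (8.6)
Corollary, the remark preceding (8.5), and (6.9)), discharged: `L(χ, s) = Σ_𝔎 χ(𝔎) Z(𝔎, s)` over the finitely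
many narrow ray classes (`rayClassLSeries_hasMeromorphicContinuation_of_partialZeta`) and each `Z(𝔎, s)`
continues (`rayClassPartialZeta_hasMeromorphicContinuation_holds`).
[cite: NeukirchANT1999, Ch. VII §8 Thm. (8.5), Cor. (8.6) and the remark preceding (8.5); Ch. VII §6 Prop. (6.9)] -/
theorem rayClassLSeries_hasMeromorphicContinuation_holds : rayClassLSeries_hasMeromorphicContinuation K :=
  rayClassLSeries_hasMeromorphicContinuation_of_partialZeta rayClassPartialZeta_hasMeromorphicContinuation_holds

end Literature.NumberTheory.LFunctions
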